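import Summits.BirchSwinnertonDyer.Rank1Residual.Additive.FormalGroupBallPointsAdd
import Literature.NumberTheory.EllipticCurves.FormalGroupMultiplication
import HarnessLib

/-!
# The formal group law computes `E₁(K)` for `K ⊇ ℚ_p` complete, II: the tangent case and the
# theorem `z(P + Q) = F(z(P), z(Q))` on `E₁(K)` (cell `b2b-bsdres`, CLASS-CLOSURE lane, class O10 —
# x1b GEN 33, class lead; file 24 of the local series — Silverman AEC VII.2.2 beyond `K = ℚ_p`)

HONEST FRAMING (cell `b2b-bsdres`, run/shared/lean/b2b/bsd-rank1-residual/, verbatim in every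
file): the goal of the cell is to DELETE the COMBINATION-SHAPED residual classes of the
Birch–Swinnerton-Dyer formula for ALL analytic-rank `≤ 1` elliptic curves over `ℚ` — "full BSD
formula for every rank `≤ 1` curve in class `C`" assembled STRICTLY from published theorems — so
that the rank-`≤ 1` remainder becomes exactly the CONSTRUCTION-SHAPED classes, which are TYPED
(missing-input `Prop`s), NOT attempted. This is not "finishing BSD". CLASS-CLOSURE lane: prove
what is provable now; shrink each hard class to its core with data; no claim beyond stated classes;
research routes on CONSTRUCTION-SHAPED X12 / O10; census / instrument output = EVIDENCE / conjecture
items, NEVER a Literature fact; `RESIDUAL-MAP.md` marks change only by signed lines. THIS FILE: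
THEOREMS ONLY (every statement proved) — no definition, no named Literature fact, no Summits-side
fact `def … : Prop`, no `sorry`, axioms standard; nothing is booked; no label / mark / count /
sub-cell moves; O10 stays OPEN / CONSTRUCTION-SHAPED; nothing about `BSD(W, p)` of any pair is
claimed.

## Content (notation of part I)

* §1 the doubling identities of `FormalGroupLawChordFormulaProofs` evaluated at `t`
  (`doubleX_at`, `doubleY_at`), `F(t, t) = [2](t)` at points, and **`ptOf_add_self`:
  `P(t) + P(t) = P(F(t, t))`** (`K ⊇ ℚ_p` has characteristic `0`, so `P(t)` is not `2`-torsion: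
  `Ỹ(t) = (a₁t − 2)X(t) + a₃t³` has norm `1`).
* §2 **`ptOf_add`: `P(u) + P(v) = P(F(u, v))` for all `u, v`** (cases `u = 0`, `v = 0`, chord,
  tangent, `v = i(u)`), and **`zCoord_add_eq_evF`: `z(P + Q) = F(z(P), z(Q))` for
  `P, Q ∈ E₁(K)`** — Silverman AEC VII.2.2 for every complete ultrametric normed field over `ℚ_p`.

References: [SilvermanAEC2009] III.2.3, IV.1–IV.2, VII.2.2.
-/

noncomputable section

open scoped Classical Topology NNReal
open Filter PowerSeries

namespace Summit.BirchSwinnertonDyer.Rank1Residual.Additive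

namespace BallEval

open Literature.NumberTheory.GaloisRepresentations.LubinTate (unitBall mem_unitBall_iff)
open Literature.NumberTheory.EllipticCurves Literature.NumberTheory.EllipticCurves.FormalGroupChart
open WeierstrassCurve

variable {p : ℕ} [hp : Fact p.Prime] {K : Type*} [NontriviallyNormedField K] [NormedAlgebra ℚ_[p] K]
  [IsUltrametricDist K] [CompleteSpace K] {M : WeierstrassCurve ℤ_[p]}

/-! ## §1 The tangent case -/

/-- `‖[2](t)‖ < 1`. [folklore] -/
theorem norm_ev₁_formalMul_lt_one {t : unitBall K} (ht : ‖(t : K)‖ < 1) (n : ℕ) :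
    ‖((ev₁ p K t (hasEval_of_norm_lt_one ht) (M.formalMul n) : unitBall K) : K)‖ < 1 :=
  (norm_ev₁_le _ ht.le (M.constantCoeff_formalMul n)).trans_lt ht

/-- Dictionary (in `𝒪_K`): `ev₁ t (X([n])) = ev₁ ([n](t)) X`. [folklore] -/
theorem ev₁_formalXMulSq_subst_formalMul {t : unitBall K} (ht : ‖(t : K)‖ < 1) (n : ℕ) :
    ev₁ p K t (hasEval_of_norm_lt_one ht) (M.formalXMulSq.subst (M.formalMul n)) =
      ev₁ p K (ev₁ p K t (hasEval_of_norm_lt_one ht) (M.formalMul n))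
        (hasEval_of_norm_lt_one (norm_ev₁_formalMul_lt_one (p := p) (M := M) ht n)) M.formalXMulSq :=
  ev₁_subst (M.constantCoeff_formalMul n) (hasEval_of_norm_lt_one ht) _ _

/-- **`F(t, t) = [2](t)`** at points (`formalMul_two`). [cite: SilvermanAEC2009, IV.2] -/
theorem coe_evF_self {t : unitBall K} (ht : ‖(t : K)‖ < 1) :
    (evF p M t t ht ht : K) = ((ev₁ p K t (hasEval_of_norm_lt_one ht) (M.formalMul 2) : unitBall K) : K) := by
  have hX' : ‖((ev₁ p K t (hasEval_of_norm_lt_one ht) PowerSeries.X : unitBall K) : K)‖ < 1 := by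
    rw [ev₁_X]; exact ht
  rw [M.formalMul_two, coe_ev₁_substPair ht PowerSeries.constantCoeff_X PowerSeries.constantCoeff_X hX' hX',
    ev_apply, evF, ev_apply]
  have e : (![t, t] : Fin 2 → unitBall K) =
      ![ev₁ p K t (hasEval_of_norm_lt_one ht) PowerSeries.X, ev₁ p K t (hasEval_of_norm_lt_one ht) PowerSeries.X] := by
    funext i; fin_cases i <;> simp [ev₁_X]
  rw [e]

variable [hE : (M.map PadicInt.Coe.ringHom).IsElliptic]

/-- **The doubling identity for `x`, at `t`** (`formalXMulSq_formalMul_two` evaluated; `A = X(t)`,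
`D = [2](t)`, `s = t`). [cite: SilvermanAEC2009, IV.2] -/
theorem doubleX_at {t : unitBall K} (ht : ‖(t : K)‖ < 1) :
    evX p M (ev₁ p K t (hasEval_of_norm_lt_one ht) (M.formalMul 2)) (norm_ev₁_formalMul_lt_one ht 2) *
        (t : K) ^ 2 *
        (((coeffHom p K M.a₁ : K) * (t : K) - 2) * evX p M t ht + (coeffHom p K M.a₃ : K) * (t : K) ^ 3) ^ 2 =
      ((ev₁ p K t (hasEval_of_norm_lt_one ht) (M.formalMul 2) : unitBall K) : K) ^ 2 *
        ((3 * evX p M t ht ^ 2 + 2 * (coeffHom p K M.a₂ : K) * (t : K) ^ 2 * evX p M t ht +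
              (coeffHom p K M.a₄ : K) * (t : K) ^ 4 + (coeffHom p K M.a₁ : K) * (t : K) * evX p M t ht) ^ 2 +
            (coeffHom p K M.a₁ : K) *
              (3 * evX p M t ht ^ 2 + 2 * (coeffHom p K M.a₂ : K) * (t : K) ^ 2 * evX p M t ht +
                (coeffHom p K M.a₄ : K) * (t : K) ^ 4 + (coeffHom p K M.a₁ : K) * (t : K) * evX p M t ht) *
              (t : K) * (((coeffHom p K M.a₁ : K) * (t : K) - 2) * evX p M t ht + (coeffHom p K M.a₃ : K) * (t : K) ^ 3) -
          (coeffHom p K M.a₂ : K) * (t : K) ^ 2 *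
            (((coeffHom p K M.a₁ : K) * (t : K) - 2) * evX p M t ht + (coeffHom p K M.a₃ : K) * (t : K) ^ 3) ^ 2 -
          2 * evX p M t ht *
            (((coeffHom p K M.a₁ : K) * (t : K) - 2) * evX p M t ht + (coeffHom p K M.a₃ : K) * (t : K) ^ 3) ^ 2) := by
  have h := congrArg (ev₁ p K t (hasEval_of_norm_lt_one ht)) M.formalXMulSq_formalMul_two
  simp only [map_mul, map_pow, map_add, map_sub, map_ofNat, ev₁_X, ev₁_C] at h
  rw [ev₁_formalXMulSq_subst_formalMul ht 2] at h
  have h' := congrArg Subtype.val h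
  simp only [Subring.coe_mul, SubmonoidClass.coe_pow, Subring.coe_add, AddSubgroupClass.coe_sub] at h'
  exact h'

/-- **The doubling identity for `y`, at `t`** (`formalXMulSq_formalMul_twoY` evaluated).
[cite: SilvermanAEC2009, IV.2] -/
theorem doubleY_at {t : unitBall K} (ht : ‖(t : K)‖ < 1) :
    (-evX p M (ev₁ p K t (hasEval_of_norm_lt_one ht) (M.formalMul 2)) (norm_ev₁_formalMul_lt_one ht 2) +
          (coeffHom p K M.a₁ : K) *
              evX p M (ev₁ p K t (hasEval_of_norm_lt_one ht) (M.formalMul 2)) (norm_ev₁_formalMul_lt_one ht 2) *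
            ((ev₁ p K t (hasEval_of_norm_lt_one ht) (M.formalMul 2) : unitBall K) : K) +
          (coeffHom p K M.a₃ : K) * ((ev₁ p K t (hasEval_of_norm_lt_one ht) (M.formalMul 2) : unitBall K) : K) ^ 3) *
        (t : K) ^ 3 * (((coeffHom p K M.a₁ : K) * (t : K) - 2) * evX p M t ht + (coeffHom p K M.a₃ : K) * (t : K) ^ 3) =
      -((3 * evX p M t ht ^ 2 + 2 * (coeffHom p K M.a₂ : K) * (t : K) ^ 2 * evX p M t ht +
              (coeffHom p K M.a₄ : K) * (t : K) ^ 4 + (coeffHom p K M.a₁ : K) * (t : K) * evX p M t ht) *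
          (evX p M (ev₁ p K t (hasEval_of_norm_lt_one ht) (M.formalMul 2)) (norm_ev₁_formalMul_lt_one ht 2) *
              (t : K) ^ 2 -
            evX p M t ht * ((ev₁ p K t (hasEval_of_norm_lt_one ht) (M.formalMul 2) : unitBall K) : K) ^ 2) *
          ((ev₁ p K t (hasEval_of_norm_lt_one ht) (M.formalMul 2) : unitBall K) : K)) +
        evX p M t ht * ((ev₁ p K t (hasEval_of_norm_lt_one ht) (M.formalMul 2) : unitBall K) : K) ^ 3 *
          (((coeffHom p K M.a₁ : K) * (t : K) - 2) * evX p M t ht + (coeffHom p K M.a₃ : K) * (t : K) ^ 3) := by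
  have h := congrArg (ev₁ p K t (hasEval_of_norm_lt_one ht)) M.formalXMulSq_formalMul_twoY
  simp only [map_mul, map_pow, map_add, map_sub, map_neg, map_ofNat, ev₁_X, ev₁_C] at h
  rw [ev₁_formalXMulSq_subst_formalMul ht 2] at h
  have h' := congrArg Subtype.val h
  simp only [Subring.coe_mul, SubmonoidClass.coe_pow, Subring.coe_add, AddSubgroupClass.coe_sub,
    NegMemClass.coe_neg] at h'
  exact h'

omit hE in
/-- `evX` depends only on the point. [folklore] -/
theorem evX_congr {t t' : unitBall K} (h : t = t') (ht : ‖(t : K)‖ < 1) (ht' : ‖(t' : K)‖ < 1) :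
    evX p M t ht = evX p M t' ht' := by
  subst h; rfl

/-- `P(t) = P(t')` forces `t = t'` (read off `z`). [folklore] -/
theorem coe_eq_of_ptOf_eq {t t' : unitBall K} (ht : ‖(t : K)‖ < 1) (ht' : ‖(t' : K)‖ < 1)
    (h : ptOf p K M t ht = ptOf p K M t' ht') : (t : K) = t' := by
  have := congrArg Affine.Point.zCoord h
  rwa [zCoord_ptOf, zCoord_ptOf] at this

/-- **`P(t) + P(t) = P(F(t, t))`** (the tangent case, including the `2`-torsion sub-case
`P(t) = −P(t)`, where `t = i(t)` and `F(t, i(t)) = 0`). [cite: SilvermanAEC2009, Prop. VII.2.2] -/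
theorem ptOf_add_self {t : unitBall K} (ht : ‖(t : K)‖ < 1) (ht0 : (t : K) ≠ 0) :
    ptOf p K M t ht + ptOf p K M t ht = ptOf p K M (evF p M t t ht ht) (norm_evF_lt_one ht ht) := by
  set A : K := evX p M t ht with hAdef
  set s : K := (t : K) with hsdef
  by_cases hy : -A / s ^ 3 = (curveK p K M).toAffine.negY (A / s ^ 2) (-A / s ^ 3)
  · -- `P(t) = -P(t)`: then `t = i(t)` and `F(t, t) = F(t, i(t)) = 0`
    have hneg : -ptOf p K M t ht = ptOf p K M t ht := by
      rw [ptOf_of_ne_zero ht ht0, Affine.Point.neg_some]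
      simp only [Affine.Point.some.injEq]
      exact ⟨trivial, hy.symm⟩
    have hti : (t : K) = ((ev₁ p K t (hasEval_of_norm_lt_one ht) M.formalNeg : unitBall K) : K) := by
      refine coe_eq_of_ptOf_eq (p := p) (M := M) ht (norm_ev₁_formalNeg_lt_one ht) ?_
      rw [← neg_ptOf ht, hneg]
    have hF0 : (evF p M t t ht ht : K) = 0 := by
      have h := coe_evF_formalNeg (p := p) (M := M) ht
      have e : (ev₁ p K t (hasEval_of_norm_lt_one ht) M.formalNeg : unitBall K) = t := Subtype.ext hti.symm
      simp only [e] at h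
      exact h
    rw [ptOf_of_eq_zero _ hF0]
    nth_rewrite 1 [← hneg]
    exact neg_add_cancel _
  -- the genuine tangent case
  have keyX := doubleX_at (p := p) (M := M) ht
  have keyY := doubleY_at (p := p) (M := M) ht
  rw [← coe_evF_self ht] at keyX keyY
  set D : K := (evF p M t t ht ht : K) with hDdef
  set XD : K := evX p M (evF p M t t ht ht) (norm_evF_lt_one ht ht) with hXDdef
  have hXD' : evX p M (ev₁ p K t (hasEval_of_norm_lt_one ht) (M.formalMul 2)) (norm_ev₁_formalMul_lt_one ht 2)
      = XD := by
    rw [hXDdef]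
    exact evX_congr (Subtype.ext (coe_evF_self (p := p) (M := M) ht).symm) _ _
  rw [hXD'] at keyX keyY
  -- `Ỹ(t) = s³ (y − negY) ≠ 0`
  set Yt : K := ((coeffHom p K M.a₁ : K) * s - 2) * A + (coeffHom p K M.a₃ : K) * s ^ 3 with hYtdef
  have hYte : Yt = s ^ 3 * (-A / s ^ 3 - (curveK p K M).toAffine.negY (A / s ^ 2) (-A / s ^ 3)) := by
    simp only [Affine.negY, curveK, map_a₁, map_a₃, RingHom.coe_comp, Function.comp_apply, Subring.coe_subtype]
    exact formalYTilde_chart _ _ _ _ ht0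
  have hYt0 : Yt ≠ 0 := by
    rw [hYte]; exact mul_ne_zero (pow_ne_zero 3 ht0) (sub_ne_zero.mpr hy)
  -- `D ≠ 0`
  have hD0 : D ≠ 0 := by
    intro hD
    have hXD1 : XD = 1 := by
      have h1 := norm_evX_sub_one_le (p := p) (M := M) (norm_evF_lt_one (p := p) (M := M) ht ht)
      rw [← hDdef, hD, norm_zero] at h1
      exact sub_eq_zero.mp (norm_le_zero_iff.mp h1)
    rw [hD, hXD1] at keyX
    have : s ^ 2 * Yt ^ 2 = 0 := by linear_combination keyX
    simp only [mul_eq_zero, pow_eq_zero_iff, ne_eq, OfNat.ofNat_ne_zero, not_false_eq_true] at this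
    rcases this with h | h
    · exact ht0 h
    · exact hYt0 h
  rw [ptOf_of_ne_zero ht ht0, ptOf_of_ne_zero _ hD0, Affine.Point.add_self_of_Y_ne hy]
  simp only [Affine.Point.some.injEq]
  have hcX := chart_doubleX ht0 hD0 keyX
  have hcY := chart_doubleY ht0 hD0 keyY
  have htanX := tangent_addX_mul (curveK p K M) hy
  have htanY := tangent_addY_mul (curveK p K M) hy
  simp only [curveK, map_a₁, map_a₂, map_a₃, map_a₄, RingHom.coe_comp, Function.comp_apply,
    Subring.coe_subtype, Affine.negY] at htanX htanY hcX hcY hy ⊢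
  have hDy : -A / s ^ 3 - (-(-A / s ^ 3) - (coeffHom p K M.a₁ : K) * (A / s ^ 2) - (coeffHom p K M.a₃ : K)) ≠ 0 :=
    sub_ne_zero.mpr hy
  have hX3 := mul_right_cancel₀ (pow_ne_zero 2 hDy) (htanX.trans hcX.symm)
  refine ⟨hX3, ?_⟩
  rw [hX3] at htanY
  have hY3 := mul_right_cancel₀ hDy (htanY.trans hcY.symm)
  linear_combination hY3

/-! ## §2 The group law on `E₁(K)` -/

/-- **`P(u) + P(v) = P(F(u, v))` for all `u, v` in the open disc.** [cite: SilvermanAEC2009, Prop. VII.2.2] -/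
theorem ptOf_add {u v : unitBall K} (hu : ‖(u : K)‖ < 1) (hv : ‖(v : K)‖ < 1) :
    ptOf p K M u hu + ptOf p K M v hv = ptOf p K M (evF p M u v hu hv) (norm_evF_lt_one hu hv) := by
  by_cases hu0 : (u : K) = 0
  · obtain rfl : u = 0 := Subtype.ext hu0
    rw [ptOf_of_eq_zero hu rfl, zero_add]
    exact ptOf_congr (coe_evF_zero_left hv hu).symm _ _
  by_cases hv0 : (v : K) = 0
  · obtain rfl : v = 0 := Subtype.ext hv0
    rw [ptOf_of_eq_zero hv rfl, add_zero]
    exact ptOf_congr (coe_evF_zero_right hu hv).symm _ _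
  by_cases hx : evX p M u hu / (u : K) ^ 2 = evX p M v hv / (v : K) ^ 2
  · rcases Affine.Y_eq_of_X_eq (equation_ptOf p K M hu hu0) (equation_ptOf p K M hv hv0) hx with hy | hy
    · -- `P(v) = P(u)`: `v = u`, tangent case
      have huv : (u : K) = v := by
        refine coe_eq_of_ptOf_eq (p := p) (M := M) hu hv ?_
        rw [ptOf_of_ne_zero hu hu0, ptOf_of_ne_zero hv hv0]
        simp only [Affine.Point.some.injEq]
        exact ⟨hx, hy⟩
      obtain rfl : u = v := Subtype.ext huv
      exact ptOf_add_self hu hu0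
    · -- `P(v) = -P(u) = P(i(u))`: `v = i(u)`, `F(u, i(u)) = 0`
      have hvi : (v : K) = ((ev₁ p K u (hasEval_of_norm_lt_one hu) M.formalNeg : unitBall K) : K) := by
        refine coe_eq_of_ptOf_eq (p := p) (M := M) hv (norm_ev₁_formalNeg_lt_one hu) ?_
        rw [← neg_ptOf hu, ptOf_of_ne_zero hu hu0, ptOf_of_ne_zero hv hv0, Affine.Point.neg_some]
        simp only [Affine.Point.some.injEq]
        exact ⟨hx.symm, by rw [hy, ← hx, Affine.negY_negY]⟩
      obtain rfl : v = ev₁ p K u (hasEval_of_norm_lt_one hu) M.formalNeg := Subtype.ext hvi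
      rw [← neg_ptOf hu, add_neg_cancel, ptOf_of_eq_zero _ (coe_evF_formalNeg hu)]
  · exact ptOf_add_of_x_ne hu hv hu0 hv0 hx

variable [hint : (curveK p K M).IsIntegral (NormedField.valuation (K := K)).integer]

/-- **The formal group law computes `E₁(K)`: `z(P + Q) = F(z(P), z(Q))`** for `P, Q ∈ E₁(K)`, `K`
any complete ultrametric normed field over `ℚ_p` (Silverman AEC VII.2.2, there for the completion of
a number field / `ℚ_p`; the tree had it for `K = ℚ_p` only, `formalGroupLaw_padicEval_holds`).
[cite: SilvermanAEC2009, Prop. VII.2.2] -/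
theorem zCoord_add_eq_evF {P Q : (curveK p K M).toAffine.Point}
    (hP : P ∈ kernel (NormedField.valuation (K := K)) (curveK p K M))
    (hQ : Q ∈ kernel (NormedField.valuation (K := K)) (curveK p K M)) :
    (P + Q).zCoord = (evF p M (zBall P hP) (zBall Q hQ) (norm_zBall_lt_one hP) (norm_zBall_lt_one hQ) : K) := by
  conv_lhs => rw [eq_ptOf_zCoord hP, eq_ptOf_zCoord hQ]
  rw [ptOf_add, zCoord_ptOf]

end BallEval

end Summit.BirchSwinnertonDyer.Rank1Residual.Additive

end
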